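import Summits.NavierStokesRegularity.NavierStokesRegularity.Theses.FilamentSkeletonRss
import Literature.Analysis.FluidPDE.GaussianWeightedSpace
import Literature.Analysis.FluidPDE.GaussianVortexKernelRadial
import Summits.NavierStokesRegularity.NavierStokesRegularity.Theorems.FilamentSkeletonRssCoreLinearInvertibilityGradientInClass
import Summits.NavierStokesRegularity.NavierStokesRegularity.Theorems.FilamentSkeletonRssCoreLinearInvertibilityClassClosure
import Summits.NavierStokesRegularity.NavierStokesRegularity.Theorems.FilamentSkeletonRssCoreLinearInvertibilityParityTools
import Summits.NavierStokesRegularity.NavierStokesRegularity.Theorems.FilamentSkeletonRssCoreLinearInvertibilityCoreBoundLamZero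
import Summits.NavierStokesRegularity.NavierStokesRegularity.Theorems.FilamentSkeletonRssCoreLinearInvertibilityCoreBoundEven
import Summits.NavierStokesRegularity.NavierStokesRegularity.Theorems.FilamentSkeletonRssCoreLinearInvertibilityOddSymmetrizerBounds
import Summits.NavierStokesRegularity.NavierStokesRegularity.Theorems.FilamentSkeletonRssCoreLinearInvertibilityOddArnold
import Summits.NavierStokesRegularity.NavierStokesRegularity.Theorems.FilamentSkeletonRssCoreLinearInvertibilityOddAttenuation
import Summits.NavierStokesRegularity.NavierStokesRegularity.Theorems.FilamentSkeletonRssCoreLinearInvertibilityArnoldGaussian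
import Summits.NavierStokesRegularity.NavierStokesRegularity.Theorems.FilamentSkeletonRssCoreLinearInvertibilityEvenSymmetrizerBounds
import Summits.NavierStokesRegularity.NavierStokesRegularity.Theorems.FilamentSkeletonRssCoreLinearInvertibilityEvenArnold
import Summits.NavierStokesRegularity.NavierStokesRegularity.Theorems.FilamentSkeletonRssCoreLinearInvertibilityRadialBlock
import Summits.NavierStokesRegularity.NavierStokesRegularity.Theorems.FilamentSkeletonRssCoreLinearInvertibilityEvenAttenuation

/-!
# Crux `CoreLinearInvertibility` (stmt-NavierStokesRegularity-17973), route `FilamentSkeletonRss` —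
# strategist line `even-level0`: the even sector closed AT LEVEL ZERO
# (integrated radial flux = Volterra–Schur coupling bound  +  fluctuation attenuation of the full operator)

State of the crux (2026-08-17T17:40Z): everything is landed except the EVEN sector for `λ ∈ (0,1)`
(`Theorems/…ModuloMaekawa`: `coreLinearInvertibility_of_maekawa` takes Maekawa's Lemma 4.1 as a
hypothesis; odd sector, `λ = 0`, parity split and class closure are proved). The lead's even-sector
block architecture is STUCK on the loop `‖M w₀‖ → ‖P₀ M w_⊥‖ → ‖P_⊥ H v_⊥‖ → λ‖M w₀‖` with `O(1)` constants
(EvenSectorAnalysis.md): the strain coupling `λ M` between the radial mode and the `k = ±2` modes costs one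
derivative in each direction.

THIS LINE never estimates a derivative of `w`. Write `w = w₀ + w_⊥` (circular mean + fluctuation),
`T = T_{λ,R}`, `‖·‖ = ‖·‖_{X_λ}`, `X_λ = L²(G_λ⁻¹ dx)`.

* `stub_radialCouplingLevel0` (NEW, the hardest stub). Circular means kill `Λ = Λ_loc + Λ_nl`
  (`P₀(Ω∂_θ w) = 0`, `P₀((K∗w)·∇G) = −P₀(G′ r⁻¹ ∂_θ ψ_w) = 0`), commute with `L = Δ + ½x·∇ + 1`, and see the
  strain only through the `cos 2θ`-coefficient `c(r) = π⁻¹∮ w cos 2θ` of `w_⊥`: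
  `P₀(T w) = L w₀ + λ (4r)⁻¹ (r² c)′`. In divergence form `r L W = J′`, `J = rW′ + r²W/2`, so ONE
  integration in `r` removes the derivative of `c`:
  `W′ + (r/2) W = r⁻¹ ∫₀ʳ s f₀ − (λ/4) r c`, `f₀ = P₀(Tw)`, whence
  `W(r) = e^{−r²/4} ( W(0) + ∫₀ʳ e^{s²/4} ( F(s)/s − (λ/4) s c(s) ) ds )`, `F(s) = ∫₀ˢ t f₀ = −∫ₛ^∞ t f₀`
  (`∫ P₀(Tw) = ∫ L_λ w = 0` for `w ∈ C²_c`). In `X = L²(e^{a r²/4} r dr)`, `a = 1 − λ ∈ (0,1)`: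
  the `c`-term is the Volterra operator with kernel `(rs)^{1/2} e^{−(2−a)(r²−s²)/8}` (row and column
  sums `≤ 8/(2−a)`: Schur), the `F`-term has the envelope `|F(s)| ≤ C‖f₀‖ min(s, e^{−a s²/8})` hence
  `|T_F(r)| ≤ C‖f₀‖ e^{−a r²/8} r⁻²`, and ZERO MASS pins `W(0)` (`|W(0)| ≤ C(‖f₀‖ + ‖c‖)`; this is where
  `coreLinearInvertibility_false_without_massZero` is honoured). Result, for every `R`:
  `‖w₀‖ ≤ C(λ) ( ‖T w‖ + ‖w − w₀‖ )` — level 0 on both sides, no weight `|x|`, no `∇w_⊥`.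
* `stub_fluctuationSmallnessEven` (plumbing of three LANDED theorems). For even `w ∈ C²_c`:
  `w_⊥ = w − w₀` is even, `C²_c`, circular-mean-free; with `u_⊥ = Φ ψ_{w_⊥}` (`stub_evenSymmetrizerBounds`:
  class, `T w_⊥ = H(w_⊥ + u_⊥) − L_λ u_⊥`, `‖L_λ u_⊥‖ + ‖u_⊥‖ ≤ C_s‖w_⊥‖`) and `T w₀ = L_λ w₀ = H w₀`
  (`Λ w₀ = 0`, `Ω∂_θ w₀ = 0`) one has `T w = H v − L_λ u_⊥` for the FULL local operator `H = L_λ − RΩ∂_θ`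
  acting on the FULL `v = w₀ + w_⊥ + u_⊥`, whose circular mean is `w₀`. `stub_evenFluctuationAttenuation`
  (landed p17153x, any Gaussian-class `v`): `‖v − v₀‖ ≤ ε₁(‖Hv‖ + ‖v‖)`; `stub_evenSymmetrizerBoundedBelow`
  (landed): `‖w_⊥‖ ≤ C_V ‖w_⊥ + u_⊥‖ = C_V‖v − v₀‖`. Hence `‖w − w₀‖ ≤ ε (‖Tw‖ + ‖w‖)`, `∀ ε ∃ R₀`.
* `coreBoundEvenPos_of` (PROVED here): `‖w‖² ≤ 2‖w₀‖² + 2‖w−w₀‖² ≤ 2C²‖Tw‖² + (2C²+2)‖w−w₀‖²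
  ≤ 2C²‖Tw‖² + ½(‖Tw‖² + ‖w‖²)` for `ε = 1/(2(C+1))`, i.e. `‖w‖² ≤ (4C²+1)‖Tw‖²`, `c = 1/(2C+1)`.
* `CoreLinearInvertibility_of` (PROVED here): the lead's landed composition (`stub_gradientInClass`,
  `stub_classClosure`, `stub_parityTools`, `stub_coreBoundLamZero`, `coreBoundOdd_of_symmetrizer`) with the
  even constants taken from `coreBoundEvenPos_of` for `λ ∈ (0,1)` and the `λ = 0` branch served by
  `stub_coreBoundLamZero` alone.

Why it dodges the stuck goal: the loop of the block architecture lives at level 2 (graph norms); here the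
radial part is controlled from the INTEGRATED flux identity (level 0 in `c`) and the non-radial part by
the attenuation of the fluctuation of the FULL `v` (the coupling `λ M w₀` sits inside `Hv` and is never
split off), so no derivative of `w_⊥` or of `w₀` is ever estimated and there is nothing to close.
Disproof used: `coreLinearInvertibility_false_without_massZero` (mass zero is used exactly once, to pin
`W(0)` in `stub_radialCouplingLevel0`); `coreLinearInvertibility_lamZero_const_le_one` (λ = 0 constant
`1/2 ≤ 1`, untouched). Numerics: kit j027618 (operator norms of the two Volterra maps in `X` as the box grows).
-/

set_option linter.dupNamespace false

noncomputable section

namespace Summit.NavierStokesRegularity.NavierStokesRegularity.Cruxes.CoreLinearInvertibility.EvenLevelZero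

open Set Function Filter MeasureTheory Topology
open Literature.Analysis.FluidPDE
open Summit.NavierStokesRegularity.NavierStokesRegularity.Theorems
open scoped InnerProductSpace Laplacian ContDiff

/-! ### Verbatim copies from the lead's landed `Theorems/…ModuloMaekawa.lean` (17:32Z; not yet built on the farm
snapshot at registration time, hence inlined under a sub-namespace; switch to the import when it is built) -/

namespace LeadCopy

/-- Weighted squares integrate to a nonnegative number (`G_λ > 0` for `λ < 1`). [folklore] -/
theorem integral_inv_gaussWeightLam_mul_sq_nonneg {lam : ℝ} (hlam : lam < 1)
    (f : EuclideanSpace ℝ (Fin 2) → ℝ) :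
    0 ≤ ∫ x, (gaussWeightLam lam x)⁻¹ * f x ^ 2 :=
  integral_nonneg fun x => mul_nonneg (inv_nonneg.2 (gaussWeightLam_pos hlam x).le) (sq_nonneg _)

/-! ### The odd sector (the new mathematics), reshaped by the lead (cycle 1)

Forward skew-symmetrisation (Maekawa's substitution read forward; cards `forward-symmetrizer-moment-fredholm`,
`capacitance-split`): for `w ∈ C²_c` put `ψ_w = N∗w` (`N = (2π)⁻¹ log|·|`, so `Δψ_w = w`, `K∗w = (∇ψ_w)^⊥`,
`x·(K∗w) = −∂_θψ_w`) and `u_w = Φ(|x|) ψ_w` with `Φ = kerWeight = G/(2Ω)`.  Then `v^G·∇u_w = ΩΦ ∂_θψ_w =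
(G/2)∂_θψ_w = (K∗w)·∇G` POINTWISE, i.e. `Λ_a u_w = Λ_b w`, hence the exact identity
`T_{λ,R} w = H_{λ,R}(w + u_w) − L_λ u_w` with the LOCAL operator `H_{λ,R} = L_λ − R v^G·∇ = L_λ − RΩ∂_θ`.
For ODD `w` with zero first moments: `‖T w‖ ≥ ‖H v‖ − ‖L_λ u_w‖ ≥ ε⁻¹‖v‖ − C₁‖w‖ ≥ (ε⁻¹C_V⁻¹ − C₁)‖w‖`, `v = w + u_w`, from
* `stub_oddSymmetrizerBounds` (provable now: `u_w ∈ C²`, odd, Gaussian class, the pointwise identity, `‖L_λ u_w‖ ≤ C₁‖w‖`);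
* `stub_oddSymmetrizerBoundedBelow` (`‖w‖ ≤ C_V ‖w + u_w‖` on {odd, first moments 0}: `I + K` is `I +` Hilbert–Schmidt on
  `X_λ^odd` with kernel `span{∂₁G, ∂₂G}` — tree `radialMode_one_eq_smul`, `radialMode_eq_zero` — and the moments pair
  non-degenerately with it; Fredholm: `Literature/Analysis/OperatorTheory/CompactPerturbationClosedRange`);
* `stub_oddAttenuation` (high-rotation attenuation of the LOCAL operator on odd Gaussian-class functions, `∀ ε ∃ R₀`:
  angular-momentum multiplier `∂_θ` + `X_λ` energy identity + radial two-zone split, card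
  `angular-momentum-multiplier-attenuation`; numerics kit j025050/j025052: `σ_min(H|odd) ≈ R^{1/2}` for `λ ≤ .9`).
-/

-- stub_oddSymmetrizerBounds: LANDED p167124 in Theorems/FilamentSkeletonRssCoreLinearInvertibilityOddSymmetrizerBounds.lean (+ tools p164787, p165489, p165938, p166327; imported above).


-- stub_gallaySverak2021: PROVED and LANDED p171406 in Theorems/FilamentSkeletonRssCoreLinearInvertibilityArnoldGaussian.lean
-- (Gallay–Šverák 2021 Thm 2.5 / Rem 2.7 at the Gaussian, from arnoldModeOne1D p171304 + arnoldModeSplit p170486 +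
-- arnoldHighModes p169941; imported above) — the Literature fact `GallaySverak2021_thm25_gaussian` now has a proof in the tree.


/-- **The symmetrizer is bounded below on the moment-free odd space** (former registered stub
`stub_oddSymmetrizerBoundedBelow`, reshape cycle 1): from the Literature fact by the landed reduction. -/
theorem oddSymmetrizerBoundedBelow_of_arnold :
    ∀ lam ∈ Set.Ioo (0 : ℝ) 1, ∃ C : ℝ, 0 < C ∧
    ∀ (w ψ u : EuclideanSpace ℝ (Fin 2) → ℝ), ContDiff ℝ 2 w → HasCompactSupport w →
    (∀ x, w (-x) = -w x) → ∫ x, x 0 * w x = 0 → ∫ x, x 1 * w x = 0 →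
    (∀ x, ψ x = ∫ y, (2 * Real.pi)⁻¹ * Real.log ‖x - y‖ * w y) →
    (∀ x, u x = kerWeight ‖x‖ * ψ x) →
    ∫ x, (gaussWeightLam lam x)⁻¹ * w x ^ 2 ≤
      C ^ 2 * ∫ x, (gaussWeightLam lam x)⁻¹ * (w x + u x) ^ 2 :=
  stub_oddSymmetrizerBoundedBelowOfArnold stub_gallaySverak2021


-- stub_oddAttenuation: LANDED p168798 in Theorems/FilamentSkeletonRssCoreLinearInvertibilityOddAttenuation.lean (+ tools p165057, p165834, p166116, p167466, p167994, p168520, p168633, p167444; imported above).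


/-- Weighted Minkowski inequality: `√∫ g (a+b)² ≤ √∫ g a² + √∫ g b²` for a weight `g ≥ 0` with
`g a², g b² ∈ L¹` (from the weighted Cauchy–Schwarz inequality of `…ClassClosureToolsA`). [folklore] -/
theorem sqrt_integral_weight_mul_add_sq_le {g a b : EuclideanSpace ℝ (Fin 2) → ℝ}
    (hg : ∀ x, 0 ≤ g x) (hgm : AEStronglyMeasurable g volume)
    (ham : AEStronglyMeasurable a volume) (hbm : AEStronglyMeasurable b volume)
    (ha : Integrable (fun x => g x * a x ^ 2)) (hb : Integrable (fun x => g x * b x ^ 2)) :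
    Real.sqrt (∫ x, g x * (a x + b x) ^ 2) ≤
      Real.sqrt (∫ x, g x * a x ^ 2) + Real.sqrt (∫ x, g x * b x ^ 2) := by
  obtain ⟨hab, hcs⟩ := abs_integral_weight_mul_mul_le (μ := volume) hg hgm ham hbm ha hb
  have hA : 0 ≤ ∫ x, g x * a x ^ 2 := integral_nonneg fun x => mul_nonneg (hg x) (sq_nonneg _)
  have hB : 0 ≤ ∫ x, g x * b x ^ 2 := integral_nonneg fun x => mul_nonneg (hg x) (sq_nonneg _)
  have hexp : ∫ x, g x * (a x + b x) ^ 2 =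
      (∫ x, g x * a x ^ 2) + 2 * (∫ x, g x * (a x * b x)) + ∫ x, g x * b x ^ 2 := by
    have e : (fun x => g x * (a x + b x) ^ 2) =
        fun x => (g x * a x ^ 2 + 2 * (g x * (a x * b x))) + g x * b x ^ 2 := by
      funext x; ring
    have h2 : Integrable (fun x => 2 * (g x * (a x * b x))) := hab.const_mul 2
    have h1 : Integrable (fun x => g x * a x ^ 2 + 2 * (g x * (a x * b x))) := ha.add h2
    rw [e, integral_add h1 hb, integral_add ha h2, integral_const_mul]
  have hle : ∫ x, g x * (a x + b x) ^ 2 ≤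
      (Real.sqrt (∫ x, g x * a x ^ 2) + Real.sqrt (∫ x, g x * b x ^ 2)) ^ 2 := by
    rw [hexp, add_sq, Real.sq_sqrt hA, Real.sq_sqrt hB]
    have := (abs_le.1 hcs).2
    nlinarith
  calc Real.sqrt (∫ x, g x * (a x + b x) ^ 2)
      ≤ Real.sqrt ((Real.sqrt (∫ x, g x * a x ^ 2) + Real.sqrt (∫ x, g x * b x ^ 2)) ^ 2) :=
        Real.sqrt_le_sqrt hle
    _ = Real.sqrt (∫ x, g x * a x ^ 2) + Real.sqrt (∫ x, g x * b x ^ 2) :=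
        Real.sqrt_sq (add_nonneg (Real.sqrt_nonneg _) (Real.sqrt_nonneg _))

/-- **The odd sector from the forward symmetrizer** (`stub_oddSymmetrizerBounds`,
`stub_oddSymmetrizerBoundedBelow`, `stub_oddAttenuation`): with `C₁, C_V` from 6a, 6b,
`ε = (2 C_V (C₁+1))⁻¹` and `R₀` from 6c, every odd `C²_c` vorticity with zero first moments obeys
`(C₁+1)² ‖w‖²_{X_λ} ≤ ‖T_{λ,R} w‖²_{X_λ}` for `R ≥ R₀`:
`‖w‖ ≤ C_V‖v‖ ≤ C_V ε ‖Hv‖ ≤ C_V ε (‖Tw‖ + C₁‖w‖)`. This is the body of the former registered stub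
`stub_coreBoundOdd` (reshape, cycle 1). -/
theorem coreBoundOdd_of_symmetrizer :
    ∀ lam ∈ Set.Ioo (0 : ℝ) 1, ∃ R₀ c : ℝ, 0 < c ∧ ∀ R : ℝ, R₀ ≤ R →
    ∀ w : EuclideanSpace ℝ (Fin 2) → ℝ, ContDiff ℝ 2 w → HasCompactSupport w →
    (∀ x, w (-x) = -w x) → ∫ x, x 0 * w x = 0 → ∫ x, x 1 * w x = 0 →
    c ^ 2 * ∫ x, (gaussWeightLam lam x)⁻¹ * w x ^ 2 ≤
      ∫ x, (gaussWeightLam lam x)⁻¹ * (strainedVorticityOperator lam w x -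
        R * (⟪gaussVortexVelocity x, gradient w x⟫_ℝ +
          ⟪biotSavart2D w x, gradient gaussVortexProfile x⟫_ℝ)) ^ 2 := by
  intro lam hlam
  have hlam1 : lam < 1 := hlam.2
  obtain ⟨C₁, hC₁, h1⟩ := stub_oddSymmetrizerBounds lam hlam
  obtain ⟨CV, hCV, h2⟩ := oddSymmetrizerBoundedBelow_of_arnold lam hlam
  set ε : ℝ := (2 * CV * (C₁ + 1))⁻¹ with hε
  have hC1pos : 0 < C₁ + 1 := by linarith
  have hεpos : 0 < ε := by rw [hε]; positivity
  obtain ⟨R₀, h3⟩ := stub_oddAttenuation lam hlam ε hεpos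
  refine ⟨R₀, C₁ + 1, hC1pos, fun R hR w hw hws hodd hm1 hm2 => ?_⟩
  -- the symmetrizer
  set ψ : EuclideanSpace ℝ (Fin 2) → ℝ := fun x => ∫ y, (2 * Real.pi)⁻¹ * Real.log ‖x - y‖ * w y
    with hψ
  set u : EuclideanSpace ℝ (Fin 2) → ℝ := fun x => kerWeight ‖x‖ * ψ x with hu
  obtain ⟨huC2, huodd, hclass, hident, hIw, hITw, hIv, hILu, hIH, hcLu, hcH, hLu⟩ :=
    h1 w ψ u hw hws hodd (fun x => rfl) (fun x => rfl)
  have hvodd : ∀ x, (fun y => w y + u y) (-x) = -(fun y => w y + u y) x := by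
    intro x; simp only [hodd x, huodd x]; ring
  have hatt := h3 R hR (fun y => w y + u y) (hw.add huC2) hvodd hclass
  have hbelow := h2 w ψ u hw hws hodd hm1 hm2 (fun x => rfl) (fun x => rfl)
  -- abbreviations for the five weighted squares
  set A := ∫ x, (gaussWeightLam lam x)⁻¹ * w x ^ 2 with hA
  set Tsq := ∫ x, (gaussWeightLam lam x)⁻¹ * (strainedVorticityOperator lam w x -
        R * (⟪gaussVortexVelocity x, gradient w x⟫_ℝ +
          ⟪biotSavart2D w x, gradient gaussVortexProfile x⟫_ℝ)) ^ 2 with hTsq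
  set Lsq := ∫ x, (gaussWeightLam lam x)⁻¹ * (strainedVorticityOperator lam u x) ^ 2 with hLsq
  set Hsq := ∫ x, (gaussWeightLam lam x)⁻¹ * (strainedVorticityOperator lam (fun y => w y + u y) x -
        R * ⟪gaussVortexVelocity x, gradient (fun y => w y + u y) x⟫_ℝ) ^ 2 with hHsq
  set Vsq := ∫ x, (gaussWeightLam lam x)⁻¹ * (w x + u x) ^ 2 with hVsq
  have hA0 : 0 ≤ A := integral_inv_gaussWeightLam_mul_sq_nonneg hlam1 _
  have hT0 : 0 ≤ Tsq := integral_inv_gaussWeightLam_mul_sq_nonneg hlam1 _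
  have hL0 : 0 ≤ Lsq := integral_inv_gaussWeightLam_mul_sq_nonneg hlam1 _
  have hH0 : 0 ≤ Hsq := integral_inv_gaussWeightLam_mul_sq_nonneg hlam1 _
  have hV0 : 0 ≤ Vsq := integral_inv_gaussWeightLam_mul_sq_nonneg hlam1 _
  -- Minkowski: √Hsq ≤ √Tsq + √Lsq, since H(w+u) = T w + L_λ u pointwise
  have hmink : Real.sqrt Hsq ≤ Real.sqrt Tsq + Real.sqrt Lsq := by
    have key := sqrt_integral_weight_mul_add_sq_le
      (fun x => (inv_nonneg.2 (gaussWeightLam_pos hlam1 x).le))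
      (continuous_inv_gaussWeightLam hlam1).aestronglyMeasurable
      (parity_aestronglyMeasurable_coreOp lam R hw) hcLu.aestronglyMeasurable (hITw R) hILu
    have e : (fun x => (gaussWeightLam lam x)⁻¹ * (strainedVorticityOperator lam w x -
        R * (⟪gaussVortexVelocity x, gradient w x⟫_ℝ +
          ⟪biotSavart2D w x, gradient gaussVortexProfile x⟫_ℝ) +
        strainedVorticityOperator lam u x) ^ 2) =
        fun x => (gaussWeightLam lam x)⁻¹ * (strainedVorticityOperator lam (fun y => w y + u y) x -
          R * ⟪gaussVortexVelocity x, gradient (fun y => w y + u y) x⟫_ℝ) ^ 2 := by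
      funext x; rw [hident R x]; ring
    rw [e] at key
    exact key
  -- square roots of the three stub inequalities
  have hsV : Real.sqrt Vsq ≤ ε * Real.sqrt Hsq := by
    calc Real.sqrt Vsq ≤ Real.sqrt (ε ^ 2 * Hsq) := Real.sqrt_le_sqrt hatt
      _ = ε * Real.sqrt Hsq := by rw [Real.sqrt_mul (sq_nonneg _), Real.sqrt_sq hεpos.le]
  have hsA : Real.sqrt A ≤ CV * Real.sqrt Vsq := by
    calc Real.sqrt A ≤ Real.sqrt (CV ^ 2 * Vsq) := Real.sqrt_le_sqrt hbelow
      _ = CV * Real.sqrt Vsq := by rw [Real.sqrt_mul (sq_nonneg _), Real.sqrt_sq hCV.le]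
  have hsL : Real.sqrt Lsq ≤ C₁ * Real.sqrt A := by
    calc Real.sqrt Lsq ≤ Real.sqrt (C₁ ^ 2 * A) := Real.sqrt_le_sqrt hLu
      _ = C₁ * Real.sqrt A := by rw [Real.sqrt_mul (sq_nonneg _), Real.sqrt_sq hC₁]
  -- bookkeeping: √A ≤ CV ε (√T + C₁ √A) and CV ε = (2(C₁+1))⁻¹
  have hCVε : CV * ε = (2 * (C₁ + 1))⁻¹ := by
    rw [hε]; field_simp
  have hsT0 : 0 ≤ Real.sqrt Tsq := Real.sqrt_nonneg _
  have hsA0 : 0 ≤ Real.sqrt A := Real.sqrt_nonneg _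
  have hchain : Real.sqrt A ≤ (2 * (C₁ + 1))⁻¹ * (Real.sqrt Tsq + C₁ * Real.sqrt A) := by
    calc Real.sqrt A ≤ CV * Real.sqrt Vsq := hsA
      _ ≤ CV * (ε * Real.sqrt Hsq) := mul_le_mul_of_nonneg_left hsV hCV.le
      _ = (CV * ε) * Real.sqrt Hsq := by ring
      _ ≤ (CV * ε) * (Real.sqrt Tsq + Real.sqrt Lsq) :=
          mul_le_mul_of_nonneg_left hmink (by rw [hCVε]; positivity)
      _ ≤ (CV * ε) * (Real.sqrt Tsq + C₁ * Real.sqrt A) := by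
          apply mul_le_mul_of_nonneg_left _ (by rw [hCVε]; positivity); linarith
      _ = (2 * (C₁ + 1))⁻¹ * (Real.sqrt Tsq + C₁ * Real.sqrt A) := by rw [hCVε]
  have hfinal : (C₁ + 1) * Real.sqrt A ≤ Real.sqrt Tsq := by
    have h2pos : 0 < 2 * (C₁ + 1) := by positivity
    have := mul_le_mul_of_nonneg_left hchain h2pos.le
    rw [← mul_assoc, mul_inv_cancel₀ h2pos.ne', one_mul] at this
    nlinarith
  -- square it
  have hsq := pow_le_pow_left₀ (mul_nonneg hC1pos.le hsA0) hfinal 2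
  rw [mul_pow, Real.sq_sqrt hA0, Real.sq_sqrt hT0] at hsq
  exact hsq

end LeadCopy

open LeadCopy

/-! ### The two registered stubs -/

/-- **Stub 1 (hardest, new): level-0 bound for the radial part with the strain coupling integrated out.**
For `λ ∈ (0,1)` there is `C > 0` such that for EVERY `R` and every mass-zero `w ∈ C²_c(ℝ²)` with circular
mean `w₀`: `w₀, w − w₀ ∈ X_λ` and `‖w₀‖²_{X_λ} ≤ C² (‖T_{λ,R} w‖²_{X_λ} + ‖w − w₀‖²_{X_λ})`.
Proof route: `P₀ Λ = 0`, `P₀(Tw) = L w₀ + λ(4r)⁻¹(r²c)′`, integrated flux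
`W′ + (r/2)W = r⁻¹∫₀ʳ s f₀ − (λ/4) r c`, Volterra–Schur in `L²(e^{(1−λ)r²/4} r dr)`, zero mass pins `W(0)`.
[Gallay–Wayne CMP 255 (2005) §4.1 (radial/non-radial split of `L`); Gallay–Maekawa arXiv:1610.08384 §4.1 (4.6);
folklore (Schur test)] -/
theorem stub_radialCouplingLevel0 :
    ∀ lam ∈ Set.Ioo (0 : ℝ) 1, ∃ C : ℝ, 0 < C ∧ ∀ (R : ℝ) (w w₀ : EuclideanSpace ℝ (Fin 2) → ℝ),
    ContDiff ℝ 2 w → HasCompactSupport w → ∫ x, w x = 0 →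
    (w₀ = fun ξ => (2 * Real.pi)⁻¹ * ∫ t in (0:ℝ)..2 * Real.pi,
      w (Real.cos t • ξ + Real.sin t • perp ξ)) →
    Integrable (fun x => (gaussWeightLam lam x)⁻¹ * w₀ x ^ 2) ∧
    Integrable (fun x => (gaussWeightLam lam x)⁻¹ * (w x - w₀ x) ^ 2) ∧
    ∫ x, (gaussWeightLam lam x)⁻¹ * w₀ x ^ 2 ≤
      C ^ 2 * ((∫ x, (gaussWeightLam lam x)⁻¹ * (strainedVorticityOperator lam w x -
        R * (⟪gaussVortexVelocity x, gradient w x⟫_ℝ +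
          ⟪biotSavart2D w x, gradient gaussVortexProfile x⟫_ℝ)) ^ 2) +
        ∫ x, (gaussWeightLam lam x)⁻¹ * (w x - w₀ x) ^ 2) := by
  sorry

/-- **Stub 2: the fluctuation of an even vorticity is attenuated by the FULL operator, at level 0.**
For `λ ∈ (0,1)` and `ε > 0` there is `R₀` such that for `R ≥ R₀` and every EVEN `w ∈ C²_c(ℝ²)` with
circular mean `w₀`: `‖w − w₀‖²_{X_λ} ≤ ε² (‖T_{λ,R} w‖²_{X_λ} + ‖w‖²_{X_λ})`.
Proof route (all inputs landed): `w_⊥ = w − w₀` is even, `C²_c`, circular-mean-free;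
`stub_evenSymmetrizerBounds` (`u_⊥ = Φψ_{w_⊥}`, `T w_⊥ = H(w_⊥+u_⊥) − L_λ u_⊥`, `‖L_λ u_⊥‖, ‖u_⊥‖ ≲ ‖w_⊥‖`),
`T w₀ = H w₀` (`Λ w₀ = 0`), so `T w = H v − L_λ u_⊥` with `v = w + u_⊥`, `v₀ = w₀`;
`stub_evenFluctuationAttenuation` on `v`; `stub_evenSymmetrizerBoundedBelow` (`‖w_⊥‖ ≤ C_V‖w_⊥ + u_⊥‖`).
[Maekawa M3AS 19 (2009) Lemma 4.2 (4.12); Gallay–Maekawa arXiv:1610.08384 §4.1; folklore] -/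
theorem stub_fluctuationSmallnessEven :
    ∀ lam ∈ Set.Ioo (0 : ℝ) 1, ∀ ε : ℝ, 0 < ε → ∃ R₀ : ℝ, ∀ R : ℝ, R₀ ≤ R →
    ∀ (w w₀ : EuclideanSpace ℝ (Fin 2) → ℝ), ContDiff ℝ 2 w → HasCompactSupport w →
    (∀ x, w (-x) = w x) →
    (w₀ = fun ξ => (2 * Real.pi)⁻¹ * ∫ t in (0:ℝ)..2 * Real.pi,
      w (Real.cos t • ξ + Real.sin t • perp ξ)) →
    ∫ x, (gaussWeightLam lam x)⁻¹ * (w x - w₀ x) ^ 2 ≤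
      ε ^ 2 * ((∫ x, (gaussWeightLam lam x)⁻¹ * (strainedVorticityOperator lam w x -
        R * (⟪gaussVortexVelocity x, gradient w x⟫_ℝ +
          ⟪biotSavart2D w x, gradient gaussVortexProfile x⟫_ℝ)) ^ 2) +
        ∫ x, (gaussWeightLam lam x)⁻¹ * w x ^ 2) := by
  sorry

/-! ### The even sector for `λ ∈ (0,1)`: level-0 absorption (proved) -/

/-- **Even sector, `0 < λ < 1`, from the two stubs**: `c = 1/(2C+1)`, `ε = 1/(2(C+1))`. -/
theorem coreBoundEvenPos_of
    (h1 : ∀ lam ∈ Set.Ioo (0 : ℝ) 1, ∃ C : ℝ, 0 < C ∧ ∀ (R : ℝ) (w w₀ : EuclideanSpace ℝ (Fin 2) → ℝ),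
      ContDiff ℝ 2 w → HasCompactSupport w → ∫ x, w x = 0 →
      (w₀ = fun ξ => (2 * Real.pi)⁻¹ * ∫ t in (0:ℝ)..2 * Real.pi,
        w (Real.cos t • ξ + Real.sin t • perp ξ)) →
      Integrable (fun x => (gaussWeightLam lam x)⁻¹ * w₀ x ^ 2) ∧
      Integrable (fun x => (gaussWeightLam lam x)⁻¹ * (w x - w₀ x) ^ 2) ∧
      ∫ x, (gaussWeightLam lam x)⁻¹ * w₀ x ^ 2 ≤
        C ^ 2 * ((∫ x, (gaussWeightLam lam x)⁻¹ * (strainedVorticityOperator lam w x -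
          R * (⟪gaussVortexVelocity x, gradient w x⟫_ℝ +
            ⟪biotSavart2D w x, gradient gaussVortexProfile x⟫_ℝ)) ^ 2) +
          ∫ x, (gaussWeightLam lam x)⁻¹ * (w x - w₀ x) ^ 2))
    (h2 : ∀ lam ∈ Set.Ioo (0 : ℝ) 1, ∀ ε : ℝ, 0 < ε → ∃ R₀ : ℝ, ∀ R : ℝ, R₀ ≤ R →
      ∀ (w w₀ : EuclideanSpace ℝ (Fin 2) → ℝ), ContDiff ℝ 2 w → HasCompactSupport w →
      (∀ x, w (-x) = w x) →
      (w₀ = fun ξ => (2 * Real.pi)⁻¹ * ∫ t in (0:ℝ)..2 * Real.pi,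
        w (Real.cos t • ξ + Real.sin t • perp ξ)) →
      ∫ x, (gaussWeightLam lam x)⁻¹ * (w x - w₀ x) ^ 2 ≤
        ε ^ 2 * ((∫ x, (gaussWeightLam lam x)⁻¹ * (strainedVorticityOperator lam w x -
          R * (⟪gaussVortexVelocity x, gradient w x⟫_ℝ +
            ⟪biotSavart2D w x, gradient gaussVortexProfile x⟫_ℝ)) ^ 2) +
          ∫ x, (gaussWeightLam lam x)⁻¹ * w x ^ 2)) :
    ∀ lam ∈ Set.Ioo (0 : ℝ) 1, ∃ R₀ c : ℝ, 0 < c ∧ ∀ R : ℝ, R₀ ≤ R →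
    ∀ w : EuclideanSpace ℝ (Fin 2) → ℝ, ContDiff ℝ 2 w → HasCompactSupport w →
    (∀ x, w (-x) = w x) → ∫ x, w x = 0 →
    c ^ 2 * ∫ x, (gaussWeightLam lam x)⁻¹ * w x ^ 2 ≤
      ∫ x, (gaussWeightLam lam x)⁻¹ * (strainedVorticityOperator lam w x -
        R * (⟪gaussVortexVelocity x, gradient w x⟫_ℝ +
          ⟪biotSavart2D w x, gradient gaussVortexProfile x⟫_ℝ)) ^ 2 := by
  intro lam hlam
  have hlam1 : lam < 1 := hlam.2
  obtain ⟨C, hC, hrad⟩ := h1 lam hlam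
  have hεpos : (0 : ℝ) < 1 / (2 * (C + 1)) := by positivity
  obtain ⟨R₀, hfl⟩ := h2 lam hlam (1 / (2 * (C + 1))) hεpos
  refine ⟨R₀, 1 / (2 * C + 1), by positivity, ?_⟩
  intro R hR w hw hwc heven hm0
  -- the circular mean of `w`
  obtain ⟨w₀, hw₀⟩ : ∃ w₀ : EuclideanSpace ℝ (Fin 2) → ℝ, w₀ = fun ξ => (2 * Real.pi)⁻¹ *
      ∫ t in (0:ℝ)..2 * Real.pi, w (Real.cos t • ξ + Real.sin t • perp ξ) := ⟨_, rfl⟩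
  obtain ⟨hI0, hId, hb⟩ := hrad R w w₀ hw hwc hm0 hw₀
  have hd := hfl R hR w w₀ hw hwc heven hw₀
  -- the weight and the three squared norms
  have hg0 : ∀ x, 0 ≤ (gaussWeightLam lam x)⁻¹ := fun x => (inv_pos.2 (gaussWeightLam_pos hlam1 x)).le
  have hgc : Continuous fun x => (gaussWeightLam lam x)⁻¹ := by
    refine Continuous.inv₀ ?_ fun x => (gaussWeightLam_pos hlam1 x).ne'
    unfold gaussWeightLam
    exact continuous_const.mul (Real.continuous_exp.comp
      ((continuous_const.mul (continuous_norm.pow 2)).neg))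
  have hIw : Integrable fun x => (gaussWeightLam lam x)⁻¹ * w x ^ 2 :=
    (hgc.mul (hw.continuous.pow 2)).integrable_of_hasCompactSupport
      (HasCompactSupport.intro hwc.isCompact fun x hx => by
        simp [image_eq_zero_of_notMem_tsupport hx])
  set a2 : ℝ := ∫ x, (gaussWeightLam lam x)⁻¹ * w x ^ 2 with ha2
  set b2 : ℝ := ∫ x, (gaussWeightLam lam x)⁻¹ * w₀ x ^ 2 with hb2
  set d2 : ℝ := ∫ x, (gaussWeightLam lam x)⁻¹ * (w x - w₀ x) ^ 2 with hd2
  set t2 : ℝ := ∫ x, (gaussWeightLam lam x)⁻¹ * (strainedVorticityOperator lam w x -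
        R * (⟪gaussVortexVelocity x, gradient w x⟫_ℝ +
          ⟪biotSavart2D w x, gradient gaussVortexProfile x⟫_ℝ)) ^ 2 with ht2
  have ha2n : 0 ≤ a2 := integral_nonneg fun x => mul_nonneg (hg0 x) (sq_nonneg _)
  have hb2n : 0 ≤ b2 := integral_nonneg fun x => mul_nonneg (hg0 x) (sq_nonneg _)
  have hd2n : 0 ≤ d2 := integral_nonneg fun x => mul_nonneg (hg0 x) (sq_nonneg _)
  have ht2n : 0 ≤ t2 := integral_nonneg fun x => mul_nonneg (hg0 x) (sq_nonneg _)
  -- `‖w‖² ≤ 2‖w₀‖² + 2‖w − w₀‖²` (pointwise, integrated)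
  have hsplit : a2 ≤ 2 * b2 + 2 * d2 := by
    have hpt : ∀ x, (gaussWeightLam lam x)⁻¹ * w x ^ 2 ≤
        2 * ((gaussWeightLam lam x)⁻¹ * w₀ x ^ 2) + 2 * ((gaussWeightLam lam x)⁻¹ * (w x - w₀ x) ^ 2) := by
      intro x
      have hx := hg0 x
      have hsq : w x ^ 2 ≤ 2 * w₀ x ^ 2 + 2 * (w x - w₀ x) ^ 2 := by
        nlinarith [sq_nonneg (w x - 2 * w₀ x)]
      nlinarith [mul_le_mul_of_nonneg_left hsq hx]
    have hR : Integrable fun x => 2 * ((gaussWeightLam lam x)⁻¹ * w₀ x ^ 2) +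
        2 * ((gaussWeightLam lam x)⁻¹ * (w x - w₀ x) ^ 2) := (hI0.const_mul 2).add (hId.const_mul 2)
    calc a2 ≤ ∫ x, 2 * ((gaussWeightLam lam x)⁻¹ * w₀ x ^ 2) +
          2 * ((gaussWeightLam lam x)⁻¹ * (w x - w₀ x) ^ 2) := integral_mono hIw hR hpt
      _ = 2 * b2 + 2 * d2 := by
          rw [integral_add (hI0.const_mul 2) (hId.const_mul 2), integral_const_mul, integral_const_mul]
  -- the two stubs in the abbreviations
  have hb' : b2 ≤ C ^ 2 * (t2 + d2) := hb
  have hd' : d2 ≤ (1 / (2 * (C + 1))) ^ 2 * (t2 + a2) := hd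
  -- absorption
  have hCε : (2 * C ^ 2 + 2) * (1 / (2 * (C + 1))) ^ 2 ≤ 1 / 2 := by
    rw [div_pow, one_pow, mul_pow, show (2:ℝ) ^ 2 = 4 by norm_num]
    rw [mul_one_div, div_le_div_iff₀ (by positivity) (by positivity)]
    nlinarith [sq_nonneg C, hC.le]
  have key : a2 ≤ (4 * C ^ 2 + 1) * t2 := by
    have h3 : (2 * C ^ 2 + 2) * d2 ≤ 1 / 2 * (t2 + a2) := by
      calc (2 * C ^ 2 + 2) * d2 ≤ (2 * C ^ 2 + 2) * ((1 / (2 * (C + 1))) ^ 2 * (t2 + a2)) :=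
            mul_le_mul_of_nonneg_left hd' (by positivity)
        _ = ((2 * C ^ 2 + 2) * (1 / (2 * (C + 1))) ^ 2) * (t2 + a2) := by ring
        _ ≤ 1 / 2 * (t2 + a2) := mul_le_mul_of_nonneg_right hCε (by positivity)
    nlinarith [hsplit, hb', h3]
  have hq : (1 / (2 * C + 1)) ^ 2 * (4 * C ^ 2 + 1) ≤ 1 := by
    rw [div_pow, one_pow, one_div, inv_mul_le_iff₀ (by positivity)]
    nlinarith [hC.le]
  calc (1 / (2 * C + 1)) ^ 2 * a2 ≤ (1 / (2 * C + 1)) ^ 2 * ((4 * C ^ 2 + 1) * t2) :=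
        mul_le_mul_of_nonneg_left key (by positivity)
    _ = ((1 / (2 * C + 1)) ^ 2 * (4 * C ^ 2 + 1)) * t2 := by ring
    _ ≤ 1 * t2 := mul_le_mul_of_nonneg_right hq ht2n
    _ = t2 := one_mul _

/-! ### From the even sector to the crux (the landed composition, even constants from above) -/

/-- **The crux from an even-sector bound on `(0,1)`**: class closure + parity split + `λ = 0` +
the unconditional odd sector (all landed, `Theorems/…ModuloMaekawa` and its imports). -/
theorem coreLinearInvertibility_of_coreBoundEvenPos
    (hEv : ∀ lam ∈ Set.Ioo (0 : ℝ) 1, ∃ R₀ c : ℝ, 0 < c ∧ ∀ R : ℝ, R₀ ≤ R →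
      ∀ w : EuclideanSpace ℝ (Fin 2) → ℝ, ContDiff ℝ 2 w → HasCompactSupport w →
      (∀ x, w (-x) = w x) → ∫ x, w x = 0 →
      c ^ 2 * ∫ x, (gaussWeightLam lam x)⁻¹ * w x ^ 2 ≤
        ∫ x, (gaussWeightLam lam x)⁻¹ * (strainedVorticityOperator lam w x -
          R * (⟪gaussVortexVelocity x, gradient w x⟫_ℝ +
            ⟪biotSavart2D w x, gradient gaussVortexProfile x⟫_ℝ)) ^ 2)
    (lam : ℝ) (hlam : lam ∈ Set.Ico (0 : ℝ) 1) :
    ∃ R₀ c : ℝ, 0 < c ∧ ∀ R : ℝ, R₀ ≤ R → ∀ w : EuclideanSpace ℝ (Fin 2) → ℝ, ContDiff ℝ 2 w →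
      Integrable (fun x => (gaussWeightLam lam x)⁻¹ * w x ^ 2) →
      (∀ x, Integrable (fun y => w y • biotSavartKernel2D (x - y))) →
      Integrable (fun x => (gaussWeightLam lam x)⁻¹ * (strainedVorticityOperator lam w x -
        R * (⟪gaussVortexVelocity x, gradient w x⟫_ℝ +
          ⟪biotSavart2D w x, gradient gaussVortexProfile x⟫_ℝ)) ^ 2) →
      ∫ x, w x = 0 → ∫ x, x 0 * w x = 0 → ∫ x, x 1 * w x = 0 →
      c ^ 2 * ∫ x, (gaussWeightLam lam x)⁻¹ * w x ^ 2 ≤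
        ∫ x, (gaussWeightLam lam x)⁻¹ * (strainedVorticityOperator lam w x -
          R * (⟪gaussVortexVelocity x, gradient w x⟫_ℝ +
            ⟪biotSavart2D w x, gradient gaussVortexProfile x⟫_ℝ)) ^ 2 := by
  have hlam1 : lam < 1 := hlam.2
  by_cases h0 : lam = 0
  · -- `λ = 0`: Gallay–Wayne skewness, `c = 1/2`, every `R`
    subst h0
    refine ⟨0, 1 / 2, by norm_num, ?_⟩
    intro R _hR w hw hwX hBS hTX hm0 hm1 hm2
    have hcore : ∀ v : EuclideanSpace ℝ (Fin 2) → ℝ, ContDiff ℝ 2 v → HasCompactSupport v →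
        ∫ x, v x = 0 → ∫ x, x 0 * v x = 0 → ∫ x, x 1 * v x = 0 →
        (1 / 2 : ℝ) ^ 2 * ∫ x, (gaussWeightLam 0 x)⁻¹ * v x ^ 2 ≤
          ∫ x, (gaussWeightLam 0 x)⁻¹ * (strainedVorticityOperator 0 v x -
            R * (⟪gaussVortexVelocity x, gradient v x⟫_ℝ +
              ⟪biotSavart2D v x, gradient gaussVortexProfile x⟫_ℝ)) ^ 2 := by
      intro v hv hvs hv0 _hv1 _hv2
      have hz := stub_coreBoundLamZero R v hv hvs hv0
      have hnn := integral_inv_gaussWeightLam_mul_sq_nonneg hlam1 v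
      nlinarith
    have hgrad := stub_gradientInClass 0 hlam R w hw hwX hBS hTX
    obtain ⟨ws, hws, hlimw, hlimT⟩ := stub_classClosure 0 hlam R w hw hwX hBS hTX hgrad hm0 hm1 hm2
    have hk : ∀ k, (1 / 2 : ℝ) ^ 2 * ∫ x, (gaussWeightLam 0 x)⁻¹ * ws k x ^ 2 ≤
        ∫ x, (gaussWeightLam 0 x)⁻¹ * (strainedVorticityOperator 0 (ws k) x -
          R * (⟪gaussVortexVelocity x, gradient (ws k) x⟫_ℝ +
            ⟪biotSavart2D (ws k) x, gradient gaussVortexProfile x⟫_ℝ)) ^ 2 := fun k =>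
      hcore (ws k) (hws k).1 (hws k).2.1 (hws k).2.2.1 (hws k).2.2.2.1 (hws k).2.2.2.2
    exact le_of_tendsto_of_tendsto' (hlimw.const_mul _) hlimT hk
  · -- `0 < λ < 1`: parity split, even sector from `hEv`, odd sector unconditional
    have hlam' : lam ∈ Set.Ioo (0 : ℝ) 1 := ⟨lt_of_le_of_ne hlam.1 (Ne.symm h0), hlam.2⟩
    obtain ⟨R₀e, ce, hce, hE⟩ := hEv lam hlam'
    obtain ⟨R₀o, co, hco, hO⟩ := coreBoundOdd_of_symmetrizer lam hlam'
    refine ⟨max R₀e R₀o, min ce co, lt_min hce hco, ?_⟩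
    intro R hR w hw hwX hBS hTX hm0 hm1 hm2
    have hc0 : 0 ≤ min ce co := (lt_min hce hco).le
    have hmin_e : (min ce co) ^ 2 ≤ ce ^ 2 := pow_le_pow_left₀ hc0 (min_le_left _ _) 2
    have hmin_o : (min ce co) ^ 2 ≤ co ^ 2 := pow_le_pow_left₀ hc0 (min_le_right _ _) 2
    have hcore : ∀ v : EuclideanSpace ℝ (Fin 2) → ℝ, ContDiff ℝ 2 v → HasCompactSupport v →
        ∫ x, v x = 0 → ∫ x, x 0 * v x = 0 → ∫ x, x 1 * v x = 0 →
        (min ce co) ^ 2 * ∫ x, (gaussWeightLam lam x)⁻¹ * v x ^ 2 ≤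
          ∫ x, (gaussWeightLam lam x)⁻¹ * (strainedVorticityOperator lam v x -
            R * (⟪gaussVortexVelocity x, gradient v x⟫_ℝ +
              ⟪biotSavart2D v x, gradient gaussVortexProfile x⟫_ℝ)) ^ 2 := by
      intro v hv hvs hv0 hv1 hv2
      obtain ⟨hec, hes, hoc, hos, heven, hodd, hme, hm1o, hm2o, hsplit, hsplitT⟩ :=
        stub_parityTools lam hlam R v hv hvs
      have hRe : R₀e ≤ R := (le_max_left _ _).trans hR
      have hRo : R₀o ≤ R := (le_max_right _ _).trans hR
      have he := hE R hRe (fun x => (v x + v (-x)) / 2) hec hes heven (by rw [hme, hv0])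
      have ho := hO R hRo (fun x => (v x - v (-x)) / 2) hoc hos hodd (by rw [hm1o, hv1])
        (by rw [hm2o, hv2])
      have hnn_e := integral_inv_gaussWeightLam_mul_sq_nonneg hlam1 (fun x => (v x + v (-x)) / 2)
      have hnn_o := integral_inv_gaussWeightLam_mul_sq_nonneg hlam1 (fun x => (v x - v (-x)) / 2)
      rw [hsplit, hsplitT]
      nlinarith
    have hgrad := stub_gradientInClass lam hlam R w hw hwX hBS hTX
    obtain ⟨ws, hws, hlimw, hlimT⟩ := stub_classClosure lam hlam R w hw hwX hBS hTX hgrad hm0 hm1 hm2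
    have hk : ∀ k, (min ce co) ^ 2 * ∫ x, (gaussWeightLam lam x)⁻¹ * ws k x ^ 2 ≤
        ∫ x, (gaussWeightLam lam x)⁻¹ * (strainedVorticityOperator lam (ws k) x -
          R * (⟪gaussVortexVelocity x, gradient (ws k) x⟫_ℝ +
            ⟪biotSavart2D (ws k) x, gradient gaussVortexProfile x⟫_ℝ)) ^ 2 := fun k =>
      hcore (ws k) (hws k).1 (hws k).2.1 (hws k).2.2.1 (hws k).2.2.2.1 (hws k).2.2.2.2
    exact le_of_tendsto_of_tendsto' (hlimw.const_mul _) hlimT hk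

/-! ### The concluding composition (kernel-checked, concludes the crux BY NAME; sorries only via the two stubs) -/

/-- **The line `even_level0`, assembled**: `CoreLinearInvertibility` from the two registered stubs
`stub_radialCouplingLevel0`, `stub_fluctuationSmallnessEven` (the only `sorry`s in this file) and the landed
theorems. This is the skeleton's composition theorem. -/
theorem CoreLinearInvertibility_of :
    Summit.NavierStokesRegularity.NavierStokesRegularity.Theses.FilamentSkeletonRss.CoreLinearInvertibility := by
  intro lam hlam
  exact coreLinearInvertibility_of_coreBoundEvenPos
    (coreBoundEvenPos_of stub_radialCouplingLevel0 stub_fluctuationSmallnessEven) lam hlam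

/-- The same implication with the two stub statements as explicit hypotheses (sorry-free on its own:
`stub₁ → stub₂ → CoreLinearInvertibility`). -/
theorem CoreLinearInvertibility_of_hyps
    (h1 : ∀ lam ∈ Set.Ioo (0 : ℝ) 1, ∃ C : ℝ, 0 < C ∧ ∀ (R : ℝ) (w w₀ : EuclideanSpace ℝ (Fin 2) → ℝ),
      ContDiff ℝ 2 w → HasCompactSupport w → ∫ x, w x = 0 →
      (w₀ = fun ξ => (2 * Real.pi)⁻¹ * ∫ t in (0:ℝ)..2 * Real.pi,
        w (Real.cos t • ξ + Real.sin t • perp ξ)) →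
      Integrable (fun x => (gaussWeightLam lam x)⁻¹ * w₀ x ^ 2) ∧
      Integrable (fun x => (gaussWeightLam lam x)⁻¹ * (w x - w₀ x) ^ 2) ∧
      ∫ x, (gaussWeightLam lam x)⁻¹ * w₀ x ^ 2 ≤
        C ^ 2 * ((∫ x, (gaussWeightLam lam x)⁻¹ * (strainedVorticityOperator lam w x -
          R * (⟪gaussVortexVelocity x, gradient w x⟫_ℝ +
            ⟪biotSavart2D w x, gradient gaussVortexProfile x⟫_ℝ)) ^ 2) +
          ∫ x, (gaussWeightLam lam x)⁻¹ * (w x - w₀ x) ^ 2))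
    (h2 : ∀ lam ∈ Set.Ioo (0 : ℝ) 1, ∀ ε : ℝ, 0 < ε → ∃ R₀ : ℝ, ∀ R : ℝ, R₀ ≤ R →
      ∀ (w w₀ : EuclideanSpace ℝ (Fin 2) → ℝ), ContDiff ℝ 2 w → HasCompactSupport w →
      (∀ x, w (-x) = w x) →
      (w₀ = fun ξ => (2 * Real.pi)⁻¹ * ∫ t in (0:ℝ)..2 * Real.pi,
        w (Real.cos t • ξ + Real.sin t • perp ξ)) →
      ∫ x, (gaussWeightLam lam x)⁻¹ * (w x - w₀ x) ^ 2 ≤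
        ε ^ 2 * ((∫ x, (gaussWeightLam lam x)⁻¹ * (strainedVorticityOperator lam w x -
          R * (⟪gaussVortexVelocity x, gradient w x⟫_ℝ +
            ⟪biotSavart2D w x, gradient gaussVortexProfile x⟫_ℝ)) ^ 2) +
          ∫ x, (gaussWeightLam lam x)⁻¹ * w x ^ 2)) :
    Summit.NavierStokesRegularity.NavierStokesRegularity.Theses.FilamentSkeletonRss.CoreLinearInvertibility := by
  intro lam hlam
  exact coreLinearInvertibility_of_coreBoundEvenPos (coreBoundEvenPos_of h1 h2) lam hlam


end Summit.NavierStokesRegularity.NavierStokesRegularity.Cruxes.CoreLinearInvertibility.EvenLevelZero
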